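import Literature.Analysis.FluidPDE.OnsagerBDSVPotentialTheory
import Literature.Analysis.FluidPDE.TorusHeatHolder
import Literature.Analysis.FunctionSpaces.TorusInverseLaplacianSup
import Literature.Analysis.FunctionSpaces.TorusHolderBridge
import Literature.Analysis.FunctionSpaces.HolderInterpolation
import HarnessLib

/-!
# Discharge of `BDSV.holderCZBound`: the second Riesz transforms are bounded on `C^α(T³)`

Buckmaster–De Lellis–Székelyhidi–Vicol, *Onsager's conjecture for admissible weak solutions*,
CPAM 72 (2019) = arXiv:1701.08678, App. C, Prop. C.1: "Fix `α ∈ (0,1)`. Periodic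
Calderón–Zygmund operators are bounded on the space of zero mean `T³`-periodic `C^α` functions"
(after Calderón–Zygmund 1954). The named fact `BDSV.holderCZBound`
(`OnsagerBDSVPotentialTheory`) transcribes it for the operators `∂ᵢ∂ⱼΔ⁻¹ = BDSV.rieszHessian i j`
through which it enters BDSV §§3–4, on smooth functions, with the accepted norms
`Torus.eContDiffHolderNorm 0 α` of the periodic lift. This file PROVES it
(`BDSV.holderCZBound_holds`).

## Proof

Not by singular integrals but by the heat semigroup on the periodic lift
(`FluidPDE/TorusHeatHolder`, continuing `FluidPDE/TorusHeatFlow` and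
`UnboundedOperators/HeatKernelBoundedData`): for smooth `f` on `T³` put `u = Δ⁻¹f`,
`g = ∂ᵢ∂ⱼu`. Then `Δg = ∂ᵢ∂ⱼΔu = ∂ᵢ∂ⱼ(f - ∫f) = ∂ᵢ∂ⱼf` (Schwarz, `Torus.laplacian_invLaplacian`),
so `TorusHeat.exists_holder_bound_lineDeriv₂` gives
`‖g̃‖_∞ + [g̃]_α ≤ K (sup|u| + [f̃]_α)` with `K = K(α)`; and `sup|u| ≤ C_Δ sup|f|`
(`Torus.norm_invLaplacian_le_of_forall_abs_le`, `TorusInverseLaplacianSup`: Fourier inversion,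
Cauchy–Schwarz and `∑_{k≠0}|k|⁻⁴ < ∞` in dimension three). Hence
`‖∂ᵢ∂ⱼΔ⁻¹f‖_{C^{0,α}} ≤ 2K(C_Δ + 1) ‖f‖_{C^{0,α}}`, the norms being `‖·‖_∞ + [·]_α` of the lifts
(`eContDiffHolderNorm_zero_eq` of `TorusHolderBridge`).

## Main statements (all proved)

* `holderWith_of_norm_sub_le`: real increment bounds give `HolderWith`;
* `BDSV.laplacian_rieszHessian`: `Δ(∂ᵢ∂ⱼΔ⁻¹f) = ∂ᵢ∂ⱼf` on `T³`;
* `BDSV.holderCZBound_holds : BDSV.holderCZBound`.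

## References

* T. Buckmaster, C. De Lellis, L. Székelyhidi Jr., V. Vicol, *Onsager's conjecture for admissible
  weak solutions*, Comm. Pure Appl. Math. 72 (2019) 229–274 = arXiv:1701.08678, App. C,
  Prop. C.1. [`BuckmasterEtAl2018`]
* A. P. Calderón, A. Zygmund, *Singular integrals and periodic functions*, Studia Math. 14 (1954)
  249–271 (the reference `[CaZy1954]` of Prop. C.1).
* A. Lunardi, *Analytic Semigroups and Optimal Regularity in Parabolic Problems* (1995), §3.1
  (Hölder estimates via the heat semigroup).
-/

noncomputable section

open MeasureTheory Set Filter Function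
open scoped ContDiff NNReal ENNReal

namespace Literature.Analysis.FunctionSpaces

/-! ## Real increment bounds give `HolderWith` -/

section ZeroOrder

variable {E' : Type*} [NormedAddCommGroup E'] {Y : Type*} [NormedAddCommGroup Y]

/-- A real increment bound `‖f x - f y‖ ≤ C ‖x - y‖^r` (`0 ≤ C`) gives `HolderWith C r f`.
[folklore] -/
theorem holderWith_of_norm_sub_le {f : E' → Y} {C : ℝ} (hC : 0 ≤ C) {r : ℝ≥0}
    (h : ∀ x y, ‖f x - f y‖ ≤ C * ‖x - y‖ ^ (r : ℝ)) : HolderWith C.toNNReal r f := by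
  intro x y
  rw [edist_dist, edist_dist, dist_eq_norm, dist_eq_norm,
    ENNReal.ofReal_rpow_of_nonneg (norm_nonneg _) (NNReal.coe_nonneg r),
    show ((C.toNNReal : ℝ≥0) : ℝ≥0∞) = ENNReal.ofReal C from rfl, ← ENNReal.ofReal_mul hC]
  exact ENNReal.ofReal_le_ofReal (h x y)

end ZeroOrder

end Literature.Analysis.FunctionSpaces

namespace Literature.Analysis.FluidPDE

namespace BDSV

open FunctionSpaces FunctionSpaces.Torus

/-! ## `Δ ∂ᵢ∂ⱼΔ⁻¹ = ∂ᵢ∂ⱼ` -/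

/-- **`Δ(∂ᵢ∂ⱼΔ⁻¹ f) = ∂ᵢ∂ⱼ f`** for smooth real `f` on `T³`: derivatives commute with `Δ`
(Schwarz, `Torus.partialDeriv_laplacian_comm`) and `Δ Δ⁻¹ f = f - ∫ f`
(`Torus.laplacian_invLaplacian`). [folklore] -/
theorem laplacian_rieszHessian {f : UnitAddTorus (Fin 3) → ℝ} (hf : IsSmooth f) (i j : Fin 3) (x : UnitAddTorus (Fin 3)) :
    Torus.laplacian (rieszHessian i j f) x =
      FunctionSpaces.Torus.partialDeriv i (FunctionSpaces.Torus.partialDeriv j f) x := by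
  have hu : IsSmooth (invLaplacian f) := isSmooth_invLaplacian hf
  have huj : IsSmooth (FunctionSpaces.Torus.partialDeriv j (invLaplacian f)) := hu.partialDeriv j
  rw [rieszHessian_def, ← partialDeriv_laplacian_comm huj i x]
  have h1 : Torus.laplacian (FunctionSpaces.Torus.partialDeriv j (invLaplacian f)) =
      FunctionSpaces.Torus.partialDeriv j (fun y => f y - ∫ z, f z) := by
    funext y
    rw [← partialDeriv_laplacian_comm hu j y]
    congr 1
    funext z
    exact laplacian_invLaplacian hf z
  have h2 : FunctionSpaces.Torus.partialDeriv j (fun y => f y - ∫ z, f z) =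
      FunctionSpaces.Torus.partialDeriv j f := by
    funext y
    rw [Torus.partialDeriv_sub_at (hf.isContDiff (by simp)) (isContDiff_const _) j y,
      Torus.partialDeriv_const_apply, sub_zero]
  rw [h1, h2]

/-! ## The discharge -/

/-- **BDSV App. C, Prop. C.1 for `∂ᵢ∂ⱼΔ⁻¹` — discharge of `BDSV.holderCZBound`.** For
`0 < α < 1` there is `C = C(α)` with `‖∂ᵢ∂ⱼΔ⁻¹ f‖_{C^{0,α}} ≤ C ‖f‖_{C^{0,α}}` for all `i, j` and
all smooth real `f` on `T³` (norms `‖·‖_∞ + [·]_α` of the periodic lift). Printed source: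
"Fix `α ∈ (0,1)`. Periodic Calderón–Zygmund operators are bounded on the space of zero mean
`T³`-periodic `C^α` functions" (BDSV 2019, App. C, Prop. C.1, citing Calderón–Zygmund 1954);
`∂ᵢ∂ⱼ(-Δ)⁻¹ = ⅓δᵢⱼ + CZ` (BDSV §3.2). Proof here: heat-semigroup representation
`g̃ = e^{Δ}g̃ - ∫₀¹ e^{σΔ}(∂ᵢ∂ⱼf)~ dσ` of `g = ∂ᵢ∂ⱼΔ⁻¹f` and the smoothing bounds of the
Gauss–Weierstrass kernel (`TorusHeat.exists_holder_bound_lineDeriv₂`), plus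
`sup|Δ⁻¹f| ≤ C_Δ sup|f|` (`Torus.norm_invLaplacian_le_of_forall_abs_le`).
[cite: BuckmasterEtAl2018, App. C Prop. C.1] -/
theorem holderCZBound_holds : holderCZBound := by
  intro α hα0 hα1
  have hα0' : (0 : ℝ) < α := by exact_mod_cast hα0
  have hα1' : (α : ℝ) < 1 := by exact_mod_cast hα1
  obtain ⟨K, hK0, hK⟩ := TorusHeat.exists_holder_bound_lineDeriv₂ (F := ℝ) (Fin 3) hα0' hα1'
  -- the inverse-Laplacian constant
  set CΔ : ℝ := (∑' k : Fin 3 → ℤ, ‖Torus.invLaplacianMultiplier k‖ ^ 2) ^ (1 / 2 : ℝ) with hCΔ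
  have hCΔ0 : 0 ≤ CΔ := Real.rpow_nonneg (tsum_nonneg fun k => sq_nonneg _) _
  have hd3 : Fintype.card (Fin 3) ≤ 3 := by simp
  -- the constant
  set C : ℝ := 2 * K * (CΔ + 1) with hC_def
  have hC0 : 0 ≤ C := by positivity
  obtain ⟨Cn, hCn⟩ : ∃ Cn : ℝ≥0, (Cn : ℝ) = C + 1 := ⟨⟨C + 1, by positivity⟩, rfl⟩
  refine ⟨Cn, fun i j f hf => ?_⟩
  have hCne : (Cn : ℝ≥0∞) ≠ 0 := by
    have : (0 : ℝ) < Cn := by rw [hCn]; positivity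
    exact ENNReal.coe_ne_zero.2 (NNReal.coe_pos.1 this).ne'
  -- unfold the norms
  unfold Torus.eContDiffHolderNorm
  rw [eContDiffHolderNorm_zero_eq, eContDiffHolderNorm_zero_eq]
  set Fl : EuclideanSpace ℝ (Fin 3) → ℝ := lift f with hFl
  set G : EuclideanSpace ℝ (Fin 3) → ℝ := lift (rieszHessian i j f) with hG
  -- the sup norm of `f` is finite
  obtain ⟨M₀, -, hM₀⟩ := TorusHeat.exists_norm_le hf.continuous
  have hsup_lt : eSupNorm Fl < ⊤ := eSupNorm_lt_top_iff.2 ⟨M₀, fun y => hM₀ _⟩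
  set M : ℝ := (eSupNorm Fl).toReal with hM_def
  have hM0 : 0 ≤ M := ENNReal.toReal_nonneg
  have hMeq : ENNReal.ofReal M = eSupNorm Fl := ENNReal.ofReal_toReal hsup_lt.ne
  have hM : ∀ z, |f z| ≤ M := by
    intro z
    obtain ⟨y, rfl⟩ := proj_surjective z
    have h := enorm_le_eSupNorm Fl y
    rw [← hMeq, ← ofReal_norm, ENNReal.ofReal_le_ofReal_iff hM0] at h
    simpa [hFl, lift_apply, Real.norm_eq_abs] using h
  -- the Hölder seminorm of `f`: infinite case is trivial
  by_cases hH : eHolderNorm α Fl = ⊤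
  · rw [hH, add_top, ENNReal.mul_top hCne]
    exact le_top
  -- finite case: `HolderWith A α Fl`
  have hmem : MemHolder α Fl := eHolderNorm_ne_top.1 hH
  set A : ℝ≥0 := nnHolderNorm α Fl with hA_def
  have hAeq : (A : ℝ≥0∞) = eHolderNorm α Fl := hmem.coe_nnHolderNorm_eq_eHolderNorm
  have hHW : HolderWith A α Fl := hmem.holderWith
  have hHb : ∀ y z, ‖Fl y - Fl z‖ ≤ A * ‖y - z‖ ^ (α : ℝ) := fun y z => by
    rw [← dist_eq_norm, ← dist_eq_norm]
    exact hHW.dist_le y z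
  -- the inverse Laplacian and the identity `Δ g = ∂ᵢ∂ⱼ f`
  set u : UnitAddTorus (Fin 3) → ℝ := invLaplacian f with hu_def
  have hu : IsSmooth u := isSmooth_invLaplacian hf
  have huB : ∀ z, ‖u z‖ ≤ CΔ * M := fun z =>
    norm_invLaplacian_le_of_forall_abs_le hd3 hf hM z
  set eI : EuclideanSpace ℝ (Fin 3) := EuclideanSpace.single i (1 : ℝ) with heI
  set eJ : EuclideanSpace ℝ (Fin 3) := EuclideanSpace.single j (1 : ℝ) with heJ
  have hnI : ‖eI‖ = 1 := by rw [heI]; simp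
  have hnJ : ‖eJ‖ = 1 := by rw [heJ]; simp
  have hgdef : rieszHessian i j f = fun z => Torus.lineDeriv (fun z' => Torus.lineDeriv u z' eJ) z eI := rfl
  have hΔ : ∀ z, Torus.laplacian (fun z => Torus.lineDeriv (fun z' => Torus.lineDeriv u z' eJ) z eI) z =
      Torus.lineDeriv (fun z' => Torus.lineDeriv f z' eJ) z eI := fun z => by
    have h := laplacian_rieszHessian hf i j z
    rw [hgdef] at h
    exact h
  -- the Hölder estimate
  obtain ⟨hb1, hb2⟩ := hK hu hf eI eJ hΔ huB A.2 hHb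
  rw [← hgdef, hnI, hnJ, mul_one, mul_one] at hb1 hb2
  set B₁ : ℝ := K * (CΔ * M + A) with hB₁
  have hB₁0 : 0 ≤ B₁ := by positivity
  have hGsup : eSupNorm G ≤ ENNReal.ofReal B₁ := eSupNorm_le_ofReal hb1
  have hGhol : eHolderNorm α G ≤ ENNReal.ofReal B₁ := by
    have := (holderWith_of_norm_sub_le hB₁0 hb2).eHolderNorm_le
    rwa [show ((B₁.toNNReal : ℝ≥0) : ℝ≥0∞) = ENNReal.ofReal B₁ from rfl] at this
  -- `2 B₁ ≤ C (M + A)`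
  have hreal : B₁ + B₁ ≤ C * (M + A) := by
    have hA0 : (0 : ℝ) ≤ A := A.2
    have h1 : CΔ * M + A ≤ (CΔ + 1) * (M + A) := by nlinarith
    calc B₁ + B₁ = 2 * K * (CΔ * M + A) := by rw [hB₁]; ring
      _ ≤ 2 * K * ((CΔ + 1) * (M + A)) := mul_le_mul_of_nonneg_left h1 (by positivity)
      _ = C * (M + A) := by rw [hC_def]; ring
  calc eSupNorm G + eHolderNorm α G ≤ ENNReal.ofReal B₁ + ENNReal.ofReal B₁ := add_le_add hGsup hGhol
    _ = ENNReal.ofReal (B₁ + B₁) := (ENNReal.ofReal_add hB₁0 hB₁0).symm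
    _ ≤ ENNReal.ofReal (C * (M + A)) := ENNReal.ofReal_le_ofReal hreal
    _ = ENNReal.ofReal C * (ENNReal.ofReal M + ENNReal.ofReal A) := by
        rw [ENNReal.ofReal_mul hC0, ENNReal.ofReal_add hM0 (NNReal.coe_nonneg A)]
    _ = ENNReal.ofReal C * (eSupNorm Fl + eHolderNorm α Fl) := by
        rw [hMeq, ENNReal.ofReal_coe_nnreal, hAeq]
    _ ≤ (Cn : ℝ≥0∞) * (eSupNorm Fl + eHolderNorm α Fl) := by
        gcongr
        rw [← ENNReal.ofReal_coe_nnreal, hCn]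
        exact ENNReal.ofReal_le_ofReal (by linarith)

end BDSV

end Literature.Analysis.FluidPDE
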